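import Literature.InformationTheory.QuantumCodes.ToricCodeLossErrorSkeletonSum
import Literature.InformationTheory.QuantumCodes.ToricCodeErasureHalf
import Literature.InformationTheory.QuantumCodes.LossThresholdOneArm
import HarnessLib

/-!
# Toric code under losses AND errors, IV: a positive error threshold for EVERY loss rate below `1/2`
# (the interior of Stace–Barrett–Doherty's phase diagram)

Topic `Literature/InformationTheory/QuantumCodes` (venture QEC, LADDER-QEC rung Q5; qec-type-03). All PROVED, no named fact,
kernel axioms. Stace, Barrett and Doherty (PRL 102 (2009) 200501) computed numerically the correctable region of the toric
code under heralded qubit LOSS (rate `y`) and Pauli ERRORS (rate `p`): a positive error threshold persists for every loss rate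
below the bond-percolation threshold `1/2` of the square lattice and disappears beyond it. The tree already PROVES the
endpoints: the loss threshold is exactly `1/2` (`erasure_accuracyThreshold_eq_half`, from Kesten's theorem) and no error
rate is tolerable at loss rates `≥ 1/2` (`mixed_accuracyThreshold_eq_zero`, `ToricCodeErasureHalf.lean`); the certified
INTERIOR so far was Dumer–Kovalev–Pryadko's region `ν·(y + 2(1-y)√(p(1-p))) < 1` (`ToricCodeMixedChannelThreshold.lean`),
i.e. loss rates `y < 1/ν ≈ 0.37` only. This file closes the gap:

* **`mixedFailureProb_le_of_oneArmDecay`** (finite size, the Peierls argument on the degraded lattice assembled from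
  `ToricCodeLossErrorRuns/Skeletons/SkeletonSum.lean`): if the one-arm probabilities of bond percolation at the loss rate
  `y` decay like `e^{-cn}` (`c > 0`), then for every error rate `0 ≤ p ≤ flipThreshold c` and every
  minimum-weight-outside-the-losses decoder of the `L × L` toric code (`L ≥ 3`),
  `Prob[failure] ≤ 2 L² K(c) e^{-cL/4}`;
* **`exists_mixedThreshold_of_lt_half`** — for EVERY loss rate `0 ≤ y < 1/2` there is `p₀ > 0` (from Kesten's PROVED decay
  `Kesten1980_expDecay`) such that every error rate `p < p₀` is below threshold for every family of
  minimum-weight-outside-the-losses decoders, with exponential decay in `L` (`mixedFamily_decaysExponentially`);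
* **`mixed_accuracyThreshold_pos_iff`** — THE PHASE BOUNDARY: for `0 ≤ y ≤ 1`, the error accuracy threshold of the toric
  code at loss rate `y` is positive `↔ y < 1/2`.

In print this interior is numerical (SBD09 Fig. 2; Ohzeki 2012); the proof here is a rigorous Peierls argument on the
random degraded lattice: failure ⇒ a non-trivial polygon whose present links are half faulty; its lost runs are disjoint
witnesses of one-arm events, priced by the van den Berg–Kesten inequality and Kesten's decay; the winding forces the length.

## References

* [StaceBarrettDoherty2009] T. M. Stace, S. D. Barrett, A. C. Doherty, *Thresholds for topological codes in the presence of
  loss*, PRL 102 (2009) 200501, arXiv:0904.3556, p. 2–3 and Fig. 2 (the correctable region of the (p_loss, p_err) plane ends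
  at p_loss = 0.5).
* [KestenCMP1980] H. Kesten, Comm. Math. Phys. 74 (1980) 41–59, Thm. 2 (1.7).
* [DumerKovalevPryadko2015] I. Dumer, A. A. Kovalev, L. P. Pryadko, PRL 115 (2015) 050502, Thm. 2 (the decoder).
* [DennisEtAl2002] Dennis–Kitaev–Landahl–Preskill, J. Math. Phys. 43 (2002) 4452, §4.3 (accuracy threshold), §5.3.
-/

namespace Literature.InformationTheory.QuantumCodes

namespace ToricCode

open Finset Matrix Filter Topology
open Literature.Probability.LatticeModels (zdGraph)
open Literature.Probability.Percolation (siteToBoundary bondPercolation Kesten1980_expDecay)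

variable {L : ℕ}

/-! ### The constants -/

/-- The Peierls constant `K(c) = 4 e^{c/2} (16/c + 3)² / (1 - e^{-c/4})`, an `L`-independent bound for the tilted step and
last-run counts `stepSum c L`, `lastSum c L`. [cite: DennisEtAl2002, §5.3 (the constant in the Peierls sum)] -/
noncomputable def peierlsConst (c : ℝ) : ℝ :=
  4 * Real.exp (c / 2) * (16 / c + 3) ^ 2 / (1 - Real.exp (-(c / 4)))

/-- The error-rate threshold function `p₀(c) = (4 e^{c/4} K(c))^{-2}`: for `p ≤ p₀(c)` the Peierls ratio
`2√p · e^{c/4} K(c)` is at most `1/2`. [cite: StaceBarrettDoherty2009, p. 3 (a finite error threshold for p_loss < 0.5)] -/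
noncomputable def flipThreshold (c : ℝ) : ℝ := (1 / (4 * Real.exp (c / 4) * peierlsConst c)) ^ 2

/-- Polynomial versus exponential: `(2R+3)² ≤ (16/c + 3)² e^{(c/4)R}` for `c > 0`. [folklore] -/
private theorem sq_le_const_mul_exp {c : ℝ} (hc : 0 < c) (R : ℕ) :
    ((2 * R + 3 : ℕ) : ℝ) ^ 2 ≤ (16 / c + 3) ^ 2 * Real.exp (c / 4 * R) := by
  have h1 : c / 8 * R + 1 ≤ Real.exp (c / 8 * R) := Real.add_one_le_exp _
  have hE1 : 1 ≤ Real.exp (c / 8 * R) := Real.one_le_exp (by positivity)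
  have hR : (R : ℝ) ≤ 8 / c * Real.exp (c / 8 * R) := by
    rw [div_mul_eq_mul_div, le_div_iff₀ hc]
    nlinarith
  have h2 : ((2 * R + 3 : ℕ) : ℝ) ≤ (16 / c + 3) * Real.exp (c / 8 * R) := by
    push_cast
    have : (3 : ℝ) ≤ 3 * Real.exp (c / 8 * R) := by nlinarith
    have h16 : 2 * (8 / c * Real.exp (c / 8 * R)) = 16 / c * Real.exp (c / 8 * R) := by ring
    nlinarith
  have h0 : 0 ≤ ((2 * R + 3 : ℕ) : ℝ) := Nat.cast_nonneg _
  have hsq : Real.exp (c / 8 * R) ^ 2 = Real.exp (c / 4 * R) := by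
    rw [← Real.exp_nat_mul]; congr 1; ring
  calc ((2 * R + 3 : ℕ) : ℝ) ^ 2 ≤ ((16 / c + 3) * Real.exp (c / 8 * R)) ^ 2 := pow_le_pow_left₀ h0 h2 2
    _ = (16 / c + 3) ^ 2 * Real.exp (c / 4 * R) := by rw [mul_pow, hsq]

/-- The finite geometric sum `Σ_{R<N} e^{-(c/4)R} ≤ 1/(1 - e^{-c/4})`. [folklore] -/
private theorem sum_exp_neg_le {c : ℝ} (hc : 0 < c) (N : ℕ) :
    ∑ R ∈ range N, Real.exp (-(c / 4)) ^ R ≤ 1 / (1 - Real.exp (-(c / 4))) := by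
  have hlt : Real.exp (-(c / 4)) < 1 := Real.exp_lt_one_iff.2 (by linarith)
  have h := geom_tail_le (Real.exp_pos (-(c / 4))).le hlt 0 N
  rwa [pow_zero, ← Finset.range_eq_Ico] at h

/-- `K(c) > 0` for `c > 0`. [cite: DennisEtAl2002, §5.3] -/
theorem peierlsConst_pos {c : ℝ} (hc : 0 < c) : 0 < peierlsConst c := by
  unfold peierlsConst
  have h1 : Real.exp (-(c / 4)) < 1 := Real.exp_lt_one_iff.2 (by linarith)
  have h2 : 0 < 16 / c + 3 := by positivity
  have := Real.exp_pos (c / 2)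
  positivity

/-- `stepSum c L ≤ K(c)` uniformly in `L` (`c > 0`). [cite: DennisEtAl2002, §5.3] -/
theorem stepSum_le_peierlsConst {c : ℝ} (hc : 0 < c) (L : ℕ) : stepSum c L ≤ peierlsConst c := by
  have hq1 : Real.exp (-(c / 4)) < 1 := Real.exp_lt_one_iff.2 (by linarith)
  have hden : 0 < 1 - Real.exp (-(c / 4)) := by linarith
  have hterm : ∀ R : ℕ, 4 * ((2 * R + 3 : ℕ) : ℝ) ^ 2 * runWeight c R ≤
      4 * Real.exp (c / 2) * (16 / c + 3) ^ 2 * Real.exp (-(c / 4)) ^ R := by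
    intro R
    have h1 := sq_le_const_mul_exp hc R
    have hw : runWeight c R = Real.exp (c / 2) * (Real.exp (-(c / 4)) ^ R * Real.exp (-(c / 4 * R))) := by
      rw [runWeight, ← Real.exp_nat_mul, ← Real.exp_add, ← Real.exp_add]
      congr 1; ring
    have hprod : Real.exp (c / 4 * R) * Real.exp (-(c / 4 * R)) = 1 := by
      rw [← Real.exp_add, add_neg_cancel, Real.exp_zero]
    have hpos1 : 0 < Real.exp (c / 2) := Real.exp_pos _
    have hpos2 : 0 < Real.exp (-(c / 4)) ^ R := pow_pos (Real.exp_pos _) R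
    have hpos3 : 0 < Real.exp (-(c / 4 * R)) := Real.exp_pos _
    rw [hw]
    have key : ((2 * R + 3 : ℕ) : ℝ) ^ 2 * Real.exp (-(c / 4 * R)) ≤ (16 / c + 3) ^ 2 := by
      have := mul_le_mul_of_nonneg_right h1 hpos3.le
      rwa [mul_assoc, hprod, mul_one] at this
    nlinarith [mul_le_mul_of_nonneg_left key (mul_pos hpos1 hpos2).le]
  calc stepSum c L = ∑ R ∈ range (rstar L + 1), 4 * ((2 * R + 3 : ℕ) : ℝ) ^ 2 * runWeight c R := rfl
    _ ≤ ∑ R ∈ range (rstar L + 1), 4 * Real.exp (c / 2) * (16 / c + 3) ^ 2 * Real.exp (-(c / 4)) ^ R :=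
        Finset.sum_le_sum fun R _ => hterm R
    _ = 4 * Real.exp (c / 2) * (16 / c + 3) ^ 2 * ∑ R ∈ range (rstar L + 1), Real.exp (-(c / 4)) ^ R := by
        rw [Finset.mul_sum]
    _ ≤ 4 * Real.exp (c / 2) * (16 / c + 3) ^ 2 * (1 / (1 - Real.exp (-(c / 4)))) :=
        mul_le_mul_of_nonneg_left (sum_exp_neg_le hc _) (by positivity)
    _ = peierlsConst c := by rw [peierlsConst]; ring

/-- `lastSum c L ≤ K(c)` uniformly in `L` (`c > 0`). [cite: DennisEtAl2002, §5.3] -/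
theorem lastSum_le_peierlsConst {c : ℝ} (hc : 0 < c) (L : ℕ) : lastSum c L ≤ peierlsConst c := by
  have hq1 : Real.exp (-(c / 4)) < 1 := Real.exp_lt_one_iff.2 (by linarith)
  have hden : 0 < 1 - Real.exp (-(c / 4)) := by linarith
  have hterm : ∀ R : ℕ, runWeight c R ≤ Real.exp (c / 2) * Real.exp (-(c / 4)) ^ R := by
    intro R
    rw [runWeight, ← Real.exp_nat_mul, ← Real.exp_add]
    apply Real.exp_le_exp.2
    have : 0 ≤ c / 4 * R := by positivity
    nlinarith
  calc lastSum c L = ∑ R ∈ range (rstar L + 1), runWeight c R := rfl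
    _ ≤ ∑ R ∈ range (rstar L + 1), Real.exp (c / 2) * Real.exp (-(c / 4)) ^ R := Finset.sum_le_sum fun R _ => hterm R
    _ = Real.exp (c / 2) * ∑ R ∈ range (rstar L + 1), Real.exp (-(c / 4)) ^ R := by rw [Finset.mul_sum]
    _ ≤ Real.exp (c / 2) * (1 / (1 - Real.exp (-(c / 4)))) :=
        mul_le_mul_of_nonneg_left (sum_exp_neg_le hc _) (Real.exp_pos _).le
    _ ≤ 4 * Real.exp (c / 2) * (16 / c + 3) ^ 2 * (1 / (1 - Real.exp (-(c / 4)))) := by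
        have h9 : (1 : ℝ) ≤ 4 * (16 / c + 3) ^ 2 := by
          have : (3 : ℝ) ≤ 16 / c + 3 := by have := div_pos (by norm_num : (0:ℝ) < 16) hc; linarith
          nlinarith
        have hpos : 0 ≤ Real.exp (c / 2) * (1 / (1 - Real.exp (-(c / 4)))) := by positivity
        nlinarith
    _ = peierlsConst c := by rw [peierlsConst]; ring

/-- `p₀(c) > 0`. [cite: StaceBarrettDoherty2009, p. 3] -/
theorem flipThreshold_pos {c : ℝ} (hc : 0 < c) : 0 < flipThreshold c := by
  unfold flipThreshold
  have := peierlsConst_pos hc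
  positivity

/-- For `0 ≤ p ≤ p₀(c)` the Peierls ratio is at most `1/2`: `e^{c/4} K(c) (2√p) ≤ 1/2`. [cite: DennisEtAl2002, §5.3] -/
theorem ratio_le_half {c : ℝ} (hc : 0 < c) {p : ℝ} (hp : p ≤ flipThreshold c) :
    Real.exp (c / 4) * peierlsConst c * (2 * Real.sqrt p) ≤ 1 / 2 := by
  have hK := peierlsConst_pos hc
  have hA : 0 < 4 * Real.exp (c / 4) * peierlsConst c := by positivity
  have hs : Real.sqrt p ≤ 1 / (4 * Real.exp (c / 4) * peierlsConst c) := by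
    rw [← Real.sqrt_sq (le_of_lt (by positivity : (0 : ℝ) < 1 / (4 * Real.exp (c / 4) * peierlsConst c)))]
    exact Real.sqrt_le_sqrt hp
  calc Real.exp (c / 4) * peierlsConst c * (2 * Real.sqrt p)
      ≤ Real.exp (c / 4) * peierlsConst c * (2 * (1 / (4 * Real.exp (c / 4) * peierlsConst c))) := by
        gcongr
    _ = 1 / 2 := by field_simp; ring

/-! ### The finite-size bound -/

open Classical in
/-- A failure probability is at most one. [cite: DennisEtAl2002, §4.4 eq. (prob_E)] -/
theorem mixedFailureProb_le_one {ι V : Type*} [Fintype V] [DecidableEq V] (H : Matrix ι V (ZMod 2))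
    (SX : Set (V → ZMod 2)) (D : ErasureDecoder V (ι → ZMod 2)) {y p : ℝ} (hy0 : 0 ≤ y) (hy1 : y ≤ 1)
    (hp0 : 0 ≤ p) (hp1 : p ≤ 1) : mixedFailureProb H SX D y p ≤ 1 := by
  unfold mixedFailureProb
  calc ∑ Er : Finset V, bernoulliWeight y Er *
        ∑ E ∈ univ.filter (fun E : Finset V => ∃ e : V → ZMod 2, supp e \ Er = E \ Er ∧
          ¬ D.Corrects (fun e => H *ᵥ e) SX Er e), bernoulliWeight p E
      ≤ ∑ Er : Finset V, bernoulliWeight y Er * 1 := by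
        refine Finset.sum_le_sum fun Er _ => mul_le_mul_of_nonneg_left ?_ (bernoulliWeight_nonneg hy0 hy1 Er)
        exact eventProb_le_one _ hp0 hp1
    _ = 1 := by rw [← Finset.sum_mul, sum_bernoulliWeight, one_mul]

open Classical in
/-- **Finite-size bound: the Peierls argument on the degraded lattice.** `L ≥ 3`; a minimum-weight-outside-the-losses
decoder `D` of the `L × L` toric code; loss rate `y ∈ [0,1]` at which the one-arm probabilities of bond percolation on `ℤ²`
decay, `P_y(0 ↔ ∂B(n)) ≤ e^{-cn}` (`c > 0`; every `y < 1/2` by Kesten's theorem); error rate `0 ≤ p ≤ p₀(c)` (`p ≤ 1`).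
Then `Prob[failure under losses y and errors p] ≤ 2 L² K(c) e^{-cL/4}`.
Proof: `exists_skeleton_of_mixed_failure` + `sum_mul_sum_filter_le_of_cover` (product union bound) + the prices
`eventProb_lossEvent_le` (BK), `eventProb_flipEvent_le`, the Peierls sum `sum_skeleton_weight_le`, and `Σ_m (1/2)^m ≤ 2`.
[cite: StaceBarrettDoherty2009, p. 2–3 and Fig. 2] [cite: DennisEtAl2002, §5.3] -/
theorem mixedFailureProb_le_of_oneArmDecay [NeZero L] (hL : 3 ≤ L) {D : ErasureDecoder (Edge L) (Syndrome L)}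
    (hD : D.IsMinWeightOutside (starMatrix L)) (y : unitInterval) {c : ℝ} (hc : 0 < c)
    (hdec : ∀ n : ℕ, (bondPercolation (zdGraph 2) y).real (siteToBoundary 2 n) ≤ Real.exp (-c * n))
    {p : ℝ} (hp0 : 0 ≤ p) (hp : p ≤ flipThreshold c) (hp1 : p ≤ 1) :
    mixedFailureProb (starMatrix L) (boundaries L) D y p ≤
      2 * (L : ℝ) ^ 2 * peierlsConst c * Real.exp (-c * L / 4) := by
  have hy0 : 0 ≤ (y : ℝ) := y.2.1
  have hy1 : (y : ℝ) ≤ 1 := y.2.2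
  set M := Fintype.card (Edge L) with hM
  -- index the skeletons of all sizes `m ≤ M`
  let ι := Σ m : Fin (M + 1), Skel L m
  let A : ι → Finset (Edge L) → Prop := fun σ Er => σ.2.Valid ∧ σ.2.lossEvent Er
  let B : ι → Finset (Edge L) → Prop := fun σ E => σ.2.flipEvent E
  -- Step 1: the product union bound
  let F : Finset (Edge L) → Finset (Edge L) → Prop := fun Er E =>
    ∃ e : Chain L, supp e \ Er = E \ Er ∧ ¬ D.Corrects (fun e => starMatrix L *ᵥ e) (boundaries L) Er e
  have hcover : ∀ Er E, F Er E → ∃ σ ∈ (univ : Finset ι), A σ Er ∧ B σ E := by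
    intro Er E hF
    obtain ⟨e, heE, hfail⟩ := hF
    obtain ⟨m, hm, s, hval, hloss, hflip⟩ := exists_skeleton_of_mixed_failure hL hD hfail heE
    exact ⟨⟨⟨m, Nat.lt_succ_of_le hm⟩, s⟩, mem_univ _, ⟨hval, hloss⟩, hflip⟩
  have h1' := sum_mul_sum_filter_le_of_cover univ A B F hcover hy0 hy1 hp0 hp1
  have h1 : mixedFailureProb (starMatrix L) (boundaries L) D y p ≤
      ∑ σ ∈ (univ : Finset ι), eventProb (A σ) y * eventProb (B σ) p := by
    unfold mixedFailureProb
    convert h1' using 6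
  -- Step 2: price each skeleton
  set θ : ℝ := 2 * Real.sqrt p with hθ
  have hθ0 : 0 ≤ θ := by positivity
  let W : ι → ℝ := fun σ =>
    if σ.2.Valid then (∏ j ∈ range (σ.1 + 1), Real.exp (-c * Skel.rad σ.2 j)) * θ ^ (σ.1 : ℕ) else 0
  have h2 : ∀ σ : ι, eventProb (A σ) y * eventProb (B σ) p ≤ W σ := by
    intro σ
    by_cases hv : σ.2.Valid
    · have hA : eventProb (A σ) y ≤ ∏ j ∈ range (σ.1 + 1), Real.exp (-c * Skel.rad σ.2 j) := by
        calc eventProb (A σ) y ≤ eventProb (Skel.lossEvent σ.2) y := eventProb_mono (fun Er h => h.2) hy0 hy1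
          _ ≤ _ := Skel.eventProb_lossEvent_le σ.2 y hdec
      have hB : eventProb (B σ) p ≤ θ ^ (σ.1 : ℕ) := Skel.eventProb_flipEvent_le σ.2 hp0 hp1
      simp only [W, if_pos hv]
      exact mul_le_mul hA hB (eventProb_nonneg _ hp0 hp1)
        (Finset.prod_nonneg fun j _ => (Real.exp_pos _).le)
    · have hA : eventProb (A σ) y = 0 := by
        have : eventProb (A σ) y ≤ eventProb (fun _ : Finset (Edge L) => False) y :=
          eventProb_mono (fun Er h => hv h.1) hy0 hy1
        rw [eventProb_false] at this
        exact le_antisymm this (eventProb_nonneg _ hy0 hy1)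
      simp only [W, if_neg hv, hA, zero_mul, le_refl]
  -- Step 3: the Peierls sum, size by size
  set ρ : ℝ := Real.exp (c / 4) * stepSum c L * θ with hρ
  have hρ0 : 0 ≤ ρ := by have := stepSum_nonneg c L; positivity
  have hρhalf : ρ ≤ 1 / 2 := by
    calc ρ ≤ Real.exp (c / 4) * peierlsConst c * θ :=
          mul_le_mul_of_nonneg_right (mul_le_mul_of_nonneg_left (stepSum_le_peierlsConst hc L) (Real.exp_pos _).le) hθ0
      _ ≤ 1 / 2 := ratio_le_half hc hp
  have h3 : ∑ σ : ι, W σ ≤ (L : ℝ) ^ 2 * lastSum c L * Real.exp (-c * L / 4) * ∑ m ∈ range (M + 1), ρ ^ m := by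
    have hsplit : ∑ σ : ι, W σ = ∑ m : Fin (M + 1), ∑ s ∈ (univ : Finset (Skel L m)).filter Skel.Valid,
        (∏ j ∈ range (m + 1), Real.exp (-c * Skel.rad s j)) * θ ^ (m : ℕ) := by
      rw [Fintype.sum_sigma]
      refine Finset.sum_congr rfl fun m _ => ?_
      rw [Finset.sum_filter]
    rw [hsplit, Finset.mul_sum, ← Fin.sum_univ_eq_sum_range]
    refine Finset.sum_le_sum fun m _ => ?_
    have := sum_skeleton_weight_le (L := L) (m : ℕ) hc.le hθ0
    rw [← hρ] at this
    exact this
  have hgeom : ∑ m ∈ range (M + 1), ρ ^ m ≤ 2 := by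
    have h := geom_tail_le hρ0 (by linarith) 0 (M + 1)
    rw [pow_zero, ← Finset.range_eq_Ico] at h
    calc ∑ m ∈ range (M + 1), ρ ^ m ≤ 1 / (1 - ρ) := h
      _ ≤ 2 := by rw [div_le_iff₀ (by linarith)]; linarith
  have hK0 := lastSum_le_peierlsConst hc L
  have hK0' := lastSum_nonneg c L
  calc mixedFailureProb (starMatrix L) (boundaries L) D y p
      ≤ ∑ σ ∈ (univ : Finset ι), eventProb (A σ) y * eventProb (B σ) p := h1
    _ ≤ ∑ σ : ι, W σ := Finset.sum_le_sum fun σ _ => h2 σ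
    _ ≤ (L : ℝ) ^ 2 * lastSum c L * Real.exp (-c * L / 4) * ∑ m ∈ range (M + 1), ρ ^ m := h3
    _ ≤ (L : ℝ) ^ 2 * peierlsConst c * Real.exp (-c * L / 4) * 2 := by
        have h0 : 0 ≤ (L : ℝ) ^ 2 * Real.exp (-c * L / 4) := by positivity
        have hs0 : 0 ≤ ∑ m ∈ range (M + 1), ρ ^ m := Finset.sum_nonneg fun m _ => pow_nonneg hρ0 m
        calc (L : ℝ) ^ 2 * lastSum c L * Real.exp (-c * L / 4) * ∑ m ∈ range (M + 1), ρ ^ m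
            = ((L : ℝ) ^ 2 * Real.exp (-c * L / 4)) * (lastSum c L * ∑ m ∈ range (M + 1), ρ ^ m) := by ring
          _ ≤ ((L : ℝ) ^ 2 * Real.exp (-c * L / 4)) * (peierlsConst c * 2) :=
              mul_le_mul_of_nonneg_left (mul_le_mul hK0 hgeom hs0 (peierlsConst_pos hc).le) h0
          _ = _ := by ring
    _ = 2 * (L : ℝ) ^ 2 * peierlsConst c * Real.exp (-c * L / 4) := by ring

/-! ### The phase boundary -/

/-- **For every loss rate below `1/2` the toric code has a positive error threshold** (the interior of
Stace–Barrett–Doherty's phase diagram, made rigorous): for `0 ≤ y < 1/2` there is `p₀ > 0` such that for EVERY family of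
minimum-weight-outside-the-losses decoders and every error rate `0 ≤ p ≤ p₀`, the failure probability of the
`(L+1) × (L+1)` toric codes under losses `y` and errors `p` DECAYS EXPONENTIALLY in `L`. (`p₀ = flipThreshold c(y)` with
Kesten's decay rate `c(y)`.) [cite: StaceBarrettDoherty2009, p. 3 and Fig. 2 (finite error threshold for every p_loss < 0.5)] [cite: KestenCMP1980, Thm. 2 (1.7)] -/
theorem mixedFamily_decaysExponentially {y : ℝ} (hy0 : 0 ≤ y) (hy : y < 1 / 2) :
    ∃ p₀ : ℝ, 0 < p₀ ∧ ∀ (D : (L : ℕ) → ErasureDecoder (Edge (L + 1)) (Syndrome (L + 1))),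
      (∀ L, (D L).IsMinWeightOutside (starMatrix (L + 1))) →
        ∀ p : ℝ, 0 ≤ p → p ≤ p₀ → DecaysExponentially (mixedFamily D y) p := by
  have hy1 : y ≤ 1 := by linarith
  set q : unitInterval := ⟨y, hy0, hy1⟩ with hq
  obtain ⟨c, hc, hdec⟩ := Kesten1980_expDecay q (by simpa [hq] using hy)
  refine ⟨min (flipThreshold c) 1, lt_min (flipThreshold_pos hc) one_pos, fun D hD p hp0 hp => ?_⟩
  have hpt : p ≤ flipThreshold c := hp.trans (min_le_left _ _)
  have hp1 : p ≤ 1 := hp.trans (min_le_right _ _)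
  -- `|P_L| ≤ B (L+1)² e^{-(c/4) L}` with `B = 2 K e^{-c/4} + e^{c/4}` (the second summand covers `L + 1 < 3`)
  set B : ℝ := 2 * peierlsConst c * Real.exp (-(c / 4)) + Real.exp (c / 4) with hB
  refine decaysExponentially_of_abs_le_poly_mul_exp (m := 2) (c := c / 4) (B := B) (by positivity) fun L => ?_
  have hnn : 0 ≤ mixedFamily D y L p := by
    unfold mixedFamily mixedFailureProb
    exact Finset.sum_nonneg fun Er _ => mul_nonneg (bernoulliWeight_nonneg hy0 hy1 _)
      (Finset.sum_nonneg fun E _ => bernoulliWeight_nonneg hp0 hp1 _)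
  rw [abs_of_nonneg hnn]
  have hK := peierlsConst_pos hc
  have hterm2 : (1 : ℝ) ≤ Real.exp (c / 4) * ((L : ℝ) + 1) ^ 2 * Real.exp (-(c / 4) * L) → L < 2 →
      mixedFamily D y L p ≤ B * ((L : ℝ) + 1) ^ 2 * Real.exp (-(c / 4) * L) := by
    intro h1 _
    have hle1 : mixedFamily D y L p ≤ 1 := mixedFailureProb_le_one _ _ _ hy0 hy1 hp0 hp1
    have : Real.exp (c / 4) * ((L : ℝ) + 1) ^ 2 * Real.exp (-(c / 4) * L) ≤
        B * ((L : ℝ) + 1) ^ 2 * Real.exp (-(c / 4) * L) := by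
      have : Real.exp (c / 4) ≤ B := by
        rw [hB]
        have : 0 ≤ 2 * peierlsConst c * Real.exp (-(c / 4)) := by positivity
        linarith
      gcongr
    linarith
  rcases lt_or_ge L 2 with hL | hL
  · refine hterm2 ?_ hL
    -- `L ∈ {0, 1}`: `e^{c/4} (L+1)² e^{-(c/4)L} ≥ 1`
    have hL1 : (L : ℝ) ≤ 1 := by exact_mod_cast (by omega : L ≤ 1)
    have hA : 1 ≤ Real.exp (c / 4) * Real.exp (-(c / 4) * L) := by
      rw [← Real.exp_add]
      exact Real.one_le_exp (by nlinarith)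
    have hB2 : (1 : ℝ) ≤ ((L : ℝ) + 1) ^ 2 := by
      have : (0 : ℝ) ≤ L := Nat.cast_nonneg L
      nlinarith
    calc (1 : ℝ) ≤ (Real.exp (c / 4) * Real.exp (-(c / 4) * L)) * ((L : ℝ) + 1) ^ 2 :=
          one_le_mul_of_one_le_of_one_le hA hB2
      _ = Real.exp (c / 4) * ((L : ℝ) + 1) ^ 2 * Real.exp (-(c / 4) * L) := by ring
  · have h := mixedFailureProb_le_of_oneArmDecay (L := L + 1) (by omega) (hD L) q hc hdec hp0 hpt hp1
    change mixedFamily D y L p ≤ _ at h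
    refine h.trans ?_
    push_cast
    have he : Real.exp (-c * ((L : ℝ) + 1) / 4) = Real.exp (-(c / 4)) * Real.exp (-(c / 4) * L) := by
      rw [← Real.exp_add]; congr 1; ring
    rw [he]
    have hpos : 0 ≤ ((L : ℝ) + 1) ^ 2 * Real.exp (-(c / 4) * L) := by positivity
    have : Real.exp (c / 4) * (((L : ℝ) + 1) ^ 2 * Real.exp (-(c / 4) * L)) ≥ 0 := by positivity
    calc 2 * ((L : ℝ) + 1) ^ 2 * peierlsConst c * (Real.exp (-(c / 4)) * Real.exp (-(c / 4) * L))
        = (2 * peierlsConst c * Real.exp (-(c / 4))) * (((L : ℝ) + 1) ^ 2 * Real.exp (-(c / 4) * L)) := by ring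
      _ ≤ B * (((L : ℝ) + 1) ^ 2 * Real.exp (-(c / 4) * L)) := by
          refine mul_le_mul_of_nonneg_right ?_ hpos
          rw [hB]
          have := Real.exp_pos (c / 4)
          linarith
      _ = B * ((L : ℝ) + 1) ^ 2 * Real.exp (-(c / 4) * L) := by ring

/-- **Threshold form**: for every loss rate `0 ≤ y < 1/2` there is `p₀ > 0` which is an error-threshold lower bound of the
toric code at loss rate `y` for EVERY family of minimum-weight-outside-the-losses decoders (`mixedFamily D y L p → 0` for
all `p < p₀`). [cite: StaceBarrettDoherty2009, p. 3 and Fig. 2] [cite: KestenCMP1980, Thm. 2 (1.7)] -/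
theorem exists_mixedThreshold_of_lt_half {y : ℝ} (hy0 : 0 ≤ y) (hy : y < 1 / 2) :
    ∃ p₀ : ℝ, 0 < p₀ ∧ ∀ (D : (L : ℕ) → ErasureDecoder (Edge (L + 1)) (Syndrome (L + 1))),
      (∀ L, (D L).IsMinWeightOutside (starMatrix (L + 1))) → IsThresholdLowerBound (mixedFamily D y) p₀ := by
  obtain ⟨p₀, hp₀, h⟩ := mixedFamily_decaysExponentially hy0 hy
  exact ⟨p₀, hp₀, fun D hD p hp0 hp => (h D hD p hp0 hp.le).belowThreshold⟩

/-- **Positive error threshold below the percolation point**: for `0 ≤ y < 1/2` and every family of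
minimum-weight-outside-the-losses decoders, `0 < accuracyThreshold (mixedFamily D y)`.
[cite: StaceBarrettDoherty2009, p. 3 and Fig. 2] -/
theorem mixed_accuracyThreshold_pos (D : (L : ℕ) → ErasureDecoder (Edge (L + 1)) (Syndrome (L + 1)))
    (hD : ∀ L, (D L).IsMinWeightOutside (starMatrix (L + 1))) {y : ℝ} (hy0 : 0 ≤ y) (hy : y < 1 / 2) :
    0 < accuracyThreshold (mixedFamily D y) := by
  obtain ⟨p₀, hp₀, h⟩ := exists_mixedThreshold_of_lt_half hy0 hy
  have hmin : IsThresholdLowerBound (mixedFamily D y) (min p₀ 1) := (h D hD).anti (min_le_left _ _)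
  exact lt_of_lt_of_le (lt_min hp₀ one_pos) (le_accuracyThreshold hmin (min_le_right _ _))

/-- **THE LOSS–ERROR PHASE BOUNDARY OF THE TORIC CODE** (Stace–Barrett–Doherty 2009, made rigorous): for a loss rate
`0 ≤ y ≤ 1` and any family of minimum-weight-outside-the-losses decoders, the toric code has a POSITIVE error accuracy
threshold at loss rate `y` if and only if `y < 1/2` — the bond-percolation threshold of the square lattice (Kesten). The
forward direction is `mixed_accuracyThreshold_eq_zero` (`ToricCodeErasureHalf.lean`: beyond `1/2` no error rate is
tolerable, for ANY decoder); the backward direction is the Peierls argument of this file.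
[cite: StaceBarrettDoherty2009, p. 1 (abstract) and Fig. 2 (the correctable region ends at p_loss = 0.5)] [cite: KestenCMP1980, Thm. 1] -/
theorem mixed_accuracyThreshold_pos_iff (D : (L : ℕ) → ErasureDecoder (Edge (L + 1)) (Syndrome (L + 1)))
    (hD : ∀ L, (D L).IsMinWeightOutside (starMatrix (L + 1))) {y : ℝ} (hy0 : 0 ≤ y) (hy1 : y ≤ 1) :
    0 < accuracyThreshold (mixedFamily D y) ↔ y < 1 / 2 := by
  constructor
  · intro h
    by_contra hge
    push Not at hge
    have := mixed_accuracyThreshold_eq_zero D hge hy1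
    linarith
  · exact mixed_accuracyThreshold_pos D hD hy0

/-- **Non-vacuity**: the canonical minimum-weight-outside-the-losses decoders qualify, so for every `0 ≤ y < 1/2` the toric
codes WITH THESE DECODERS have a positive error threshold. [cite: DumerKovalevPryadko2015, p. 3 (exhaustive search decoder)] -/
theorem minWeightOutside_mixed_accuracyThreshold_pos {y : ℝ} (hy0 : 0 ≤ y) (hy : y < 1 / 2) :
    0 < accuracyThreshold (mixedFamily (fun L => ErasureDecoder.minWeightOutside (starMatrix (L + 1))) y) :=
  mixed_accuracyThreshold_pos _ (fun L => minWeightOutside_isMinWeightOutside_toric (L + 1)) hy0 hy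

end ToricCode

end Literature.InformationTheory.QuantumCodes
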